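import Summits.Ventures.LatticeQCDFlow.Scaling.UnitSurvivalKLogK
import Summits.Ventures.LatticeQCDFlow.Scaling.FlowStarMixingCeiling
import Summits.Ventures.LatticeQCDFlow.Scaling.DominatedStarGapAndMixing

/-!
HONEST FRAMING: exact (Metropolis-corrected) sampling algorithms for lattice gauge theory; figures
of merit are autocorrelation/cost numbers at stated couplings and volumes; no continuum-physics
claim.

# FlowStarKLogKFloor — PERFECT FLOWS DO NOT BEAT `(K/(t(1−t)))·log K` EITHER: FOR THE MAP-ASSISTED HOT-ONLY HUB WHOSE
# LEVEL MAPS PUSH `μ_0` EXACTLY ONTO EACH COLD LAW, AT UNIFORM LISTING (`m = cK`, `K ≥ 8`, `|S| ≥ 20(K+1)`, EXACT HOT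
# SAMPLER, `0 < t < 1`), `t_mix(1/4) ≥ (K/(t(1−t)) − 1)·log(K/32)` (lean-2 GEN-27, ours)

Venture-side (OURS).  Cell `lqcd-flow` (pub-lqcd), unit `pub-lqcd-lean-2-g27`, 2026-08-27/28.  Chapter M, the floor
side, file 8.  THE SCHEME is the perfectly transported flow hub of `Scaling/FlowStarMixingCeiling`: hub list
`e_r = (0, κ_r+1)` carrying the LEVEL map `φ_{κ_r}` on each entry, positive laws `μ_0, …, μ_K` with `Σ μ_0 = 1` and
PERFECT TRANSPORT `μ_{k+1}(φ_k u) = μ_0(u)`, hot-only updates (weight `1` at level `0`), EXACT hot sampler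
`M_0(u,·) = μ_0`, `μ_k`-reversible row-stochastic cold kernels (they never act); `P = t·GSw + (1−t)·coordKernel M 0`.
By `flowStar_worstTvDist_eq` its distance profile is that of the idealised star with the relabelled kernels (the hot
kernel is unchanged by the relabelling), to which `Scaling/UnitSurvivalKLogK` applies verbatim.

## What is proved

* **`flowStar_worstTvDist_gt_quarter`** — uniform listing `m = cK` (every cold level listed exactly `c ≥ 1` times),
  `K ≥ 8`, a state `s` with `(K+1)μ_0(s) ≤ 1/20`, a value `u ≠ s`: every `n` with `(1 − t(1−t)/K)ⁿ·K ≥ 32` has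
  `d(n) > 1/4`.
* **`flowStar_KlogK_floor`** — `|S| ≥ 20(K+1)`, `1/4`-close at some time:
  **`t_mix(1/4) ≥ (K/(t(1−t)) − 1)·log(K/32)`**.

Reading (no numerics implied): with `Scaling/FlowStarMixingCeiling` (`t_mix(ε) ≤ ⌈(2K/(t(1−t)))·log((K+1)/(tε))⌉` at
uniform listing) the perfectly trained flow hub mixes in `Θ((K/(t(1−t)))·log K)` steps from both sides, for every
swap fraction: exact transports remove every rejection, but each unit of stale content still survives `≈ 1/(1−t)`
hub visits and the last of `K` units survives `≈ log K` times longer than a typical one.  NOT CLAIMED: the constant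
inside the logarithm; imperfect maps; anything measured.  Literature grade (cell rule): OWN RESULT
(`Scaling/UnitSurvivalKLogK` through the conjugacy of `Scaling/FlowStarMixingCeiling`); nothing cited as a fact; no
new bib keys.
-/

noncomputable section

open Finset Function
open Literature.Probability.MarkovChains

namespace Summit.Ventures.LatticeQCDFlow.Scaling

variable {S : Type*} [Fintype S] [DecidableEq S] {K m : ℕ} {μ : Fin (K + 1) → S → ℝ} {M : Fin (K + 1) → S → S → ℝ}
  {t : ℝ}

section FlowKLogK
variable (κ : Fin m → Fin K) (φ : Fin K → Equiv.Perm S)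

/-- **SURVIVAL BEYOND `n` FOR THE PERFECTLY TRANSPORTED FLOW HUB:** uniform listing `m = cK`, `K ≥ 8`, exact hot
sampler, `0 < t < 1`, a state `s` with `(K+1)μ_0(s) ≤ 1/20`, a value `u ≠ s`; every `n` with `(1 − t(1−t)/K)ⁿ·K ≥ 32`
has **`d(n) > 1/4`**. [ours] -/
theorem flowStar_worstTvDist_gt_quarter (hK : 8 ≤ K) (ht0 : 0 < t) (ht1 : t < 1) (hμ : ∀ k x, 0 < μ k x)
    (hμ01 : ∑ v, μ 0 v = 1) (hM : ∀ k, IsRowStochastic (M k)) (hM0 : ∀ u v, M 0 u v = μ 0 v)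
    (hperf : ∀ (k : Fin K) (u : S), μ k.succ (φ k u) = μ 0 u) {c : ℕ} (hc1 : 1 ≤ c)
    (hcu : ∀ p' : Fin K, (univ.filter (fun r : Fin m => κ r = p')).card = c) (hmc : m = c * K)
    (s u : S) (hus : u ≠ s) (hδ : ((K : ℝ) + 1) * μ 0 s ≤ 1 / 20) {n : ℕ} (hn : 32 ≤ (1 - t * (1 - t) / K) ^ n * K) :
    1 / 4 < worstTvDist (fun y z : Fin (K + 1) → S =>
          t * ptGraphSwap μ (fun r : Fin m => ((0 : Fin (K + 1)), (κ r).succ)) (fun r => φ (κ r)) y z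
          + (1 - t) * prodKernel (fun k : Fin (K + 1) => if k = 0 then (1 : ℝ) else 0) M y z) (tensorFun μ) n := by
  rw [flowStar_worstTvDist_eq κ φ hμ hperf n]
  refine unitSurvival_worstTvDist_gt_quarter κ hK ht0 ht1 (fun v => hμ 0 v) hμ01 (relabel_kernels_isRowStochastic φ hM)
    (fun u v => ?_) hc1 hcu hmc s u hus hδ hn
  simp only [Fin.cons_zero, Equiv.refl_symm, Equiv.refl_apply]
  exact hM0 u v

/-- **THE `K·log K` FLOOR FOR THE PERFECTLY TRANSPORTED FLOW HUB: `t_mix(1/4) ≥ (K/(t(1−t)) − 1)·log(K/32)`** at uniform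
listing (`m = cK`, `K ≥ 8`, `|S| ≥ 20(K+1)`, exact hot sampler, `μ_k`-reversible kernels, `0 < t < 1`, `1/4`-close at
some time). [ours] -/
theorem flowStar_KlogK_floor (hK : 8 ≤ K) (hS : 20 * (K + 1) ≤ Fintype.card S) (ht0 : 0 < t) (ht1 : t < 1)
    (hμ : ∀ k x, 0 < μ k x) (hμ01 : ∑ v, μ 0 v = 1) (hM : ∀ k, IsRowStochastic (M k))
    (hMrev : ∀ k, DetailedBalance (μ k) (M k)) (hM0 : ∀ u v, M 0 u v = μ 0 v)
    (hperf : ∀ (k : Fin K) (u : S), μ k.succ (φ k u) = μ 0 u) {c : ℕ} (hc1 : 1 ≤ c)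
    (hcu : ∀ p' : Fin K, (univ.filter (fun r : Fin m => κ r = p')).card = c) (hmc : m = c * K)
    (hmix : ∃ t₀, worstTvDist (fun y z : Fin (K + 1) → S =>
          t * ptGraphSwap μ (fun r : Fin m => ((0 : Fin (K + 1)), (κ r).succ)) (fun r => φ (κ r)) y z
          + (1 - t) * prodKernel (fun k : Fin (K + 1) => if k = 0 then (1 : ℝ) else 0) M y z) (tensorFun μ) t₀ ≤ 1 / 4) :
    ((K : ℝ) / (t * (1 - t)) - 1) * Real.log (K / 32)
      ≤ (mixingTime (fun y z : Fin (K + 1) → S =>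
          t * ptGraphSwap μ (fun r : Fin m => ((0 : Fin (K + 1)), (κ r).succ)) (fun r => φ (κ r)) y z
          + (1 - t) * prodKernel (fun k : Fin (K + 1) => if k = 0 then (1 : ℝ) else 0) M y z) (tensorFun μ) (1 / 4) : ℝ) := by
  have hKr : (8 : ℝ) ≤ K := by exact_mod_cast hK
  have hK0 : (0 : ℝ) < K := by linarith
  have h1t : 0 < 1 - t := by linarith
  have htt : 0 < t * (1 - t) := mul_pos ht0 h1t
  have hlam0 : 0 < t * (1 - t) / K := div_pos htt hK0
  have hlam1 : t * (1 - t) / K < 1 := by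
    rw [div_lt_iff₀ hK0]; nlinarith [sq_nonneg (t - 1 / 2)]
  -- a rare value `s` and a value `u ≠ s`
  have hSpos : 0 < Fintype.card S := by omega
  haveI : Nonempty S := Fintype.card_pos_iff.mp hSpos
  obtain ⟨s, hs⟩ := exists_rare_state (μ := fun _ : Fin (K + 1) => μ 0) (fun _ => hμ01)
  have hcard : (0 : ℝ) < Fintype.card S := Nat.cast_pos.mpr hSpos
  have hS' : 20 * ((K : ℝ) + 1) ≤ Fintype.card S := by exact_mod_cast hS
  have hsum : ∑ _k : Fin (K + 1), μ 0 s = ((K : ℝ) + 1) * μ 0 s := by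
    simp only [sum_const, card_univ, Fintype.card_fin, nsmul_eq_mul, Nat.cast_add, Nat.cast_one]
  rw [hsum] at hs
  have hδ : ((K : ℝ) + 1) * μ 0 s ≤ 1 / 20 := hs.trans (by rw [div_le_iff₀ hcard]; linarith)
  haveI hnt : Nontrivial S := by
    rw [← Fintype.one_lt_card_iff_nontrivial]; omega
  obtain ⟨u, hus⟩ := exists_ne s
  -- the scheme is a transition matrix with stationary law `π̃`
  have hw0 : ∀ k : Fin (K + 1), 0 ≤ (if k = 0 then (1 : ℝ) else 0) := fun k => by split_ifs <;> norm_num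
  have hw1 : ∑ k : Fin (K + 1), (if k = 0 then (1 : ℝ) else 0) = 1 := by
    rw [Finset.sum_ite_eq' univ (0 : Fin (K + 1)), if_pos (mem_univ _)]
  have hPst := weightedScheme_isRowStochastic (t := t) (w := fun k : Fin (K + 1) => if k = 0 then (1 : ℝ) else 0)
    (ptGraphSwap_isRowStochastic (e := fun r : Fin m => ((0 : Fin (K + 1)), (κ r).succ)) (φ := fun r => φ (κ r)) hμ)
    hM hw0 hw1 ht0.le ht1.le
  have hst := dominatedStar_isStationary κ (fun r => φ (κ r)) (t := t)
    (w := fun k : Fin (K + 1) => if k = 0 then (1 : ℝ) else 0) ht0.le ht1.le hw0 hw1 hμ hM hMrev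
  have h := mixingTime_ge_KlogK_of_floor hPst hst hlam0 hlam1 hK0
    (fun n hn => flowStar_worstTvDist_gt_quarter κ φ hK ht0 ht1 hμ hμ01 hM hM0 hperf hc1 hcu hmc s u hus hδ hn) hmix
  have hcoef : (K : ℝ) / (t * (1 - t)) - 1 = (1 - t * (1 - t) / K) / (t * (1 - t) / K) := by field_simp
  rw [hcoef]
  exact h

end FlowKLogK

end Summit.Ventures.LatticeQCDFlow.Scaling

end
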